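import Summits.AtomisticToContinuum.HydrodynamicLimit.Theorems.RelayRaceLocalityNearConstantShortTimeHLGoodEvents
import Summits.AtomisticToContinuum.HydrodynamicLimit.Theorems.RelayRaceLocalityNearConstantShortTimeHLDefectLinearity
import Summits.AtomisticToContinuum.HydrodynamicLimit.Theorems.RelayRaceLocalityNearConstantShortTimeHLFieldBounds
import Summits.AtomisticToContinuum.HydrodynamicLimit.Theorems.RelayRaceLocalityNearConstantShortTimeHLSolutionTests
import Summits.AtomisticToContinuum.HydrodynamicLimit.Theorems.RelayRaceLocalityNearConstantShortTimeHLEntropyFluxRemainderA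
import Literature.Analysis.FunctionSpaces.TorusCalculusProofs
import HarnessLib

/-!
# Crux `NearConstantShortTimeHL` (stmt-AtomisticToContinuum-12502), line `small-tilt-domination`:
# stub `good_event_package` (level 1a of the Grönwall assembly)

Support file for the crux `…Theses.RelayRaceLocality.NearConstantShortTimeHL`, line `small-tilt-domination`
(route: Yau's relative-entropy method, Grönwall assembly `stub_dynamic`; lead c4), registered stub
**`good_event_package`**: the GOOD EVENTS of Yau's method, packaged "eventually in `N`". From the event import
`P N A ≤ e^{aI n_N} G N A`, the two closure K-stubs (`G`-exponential smallness `e^{-c₀ n_N}`, `aI < c₀`, of "caps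
hold on the window but the windowed weak-form defect against an admissible test exceeds `δ`") and the cap
failures of `P`-probability `→ 0`, it produces a `C¹` constant `Λ` of the log-profile rows, a diagonal grid index
`ι(N) → ∞` and measurable good events `G' N`, `P N (G' N)ᶜ → 0`, with, eventually in `N`: `0 < ι N`,
`0 < ℓ_N < 1/2` (`ℓ_N = n_N^{-1/4}`), modulus `1/(ι N + 1)` of `∂ₜλ⁰, ∂ₜλ, ∂ₜλ⁴, ∇λ⁰` at scale `ℓ_N` on `[0, t]`,
and on `G' N` the caps on `[0, t]` and the defect bounds `2Λ/(ι N + 1)²` for the plain rows `λ = u/θ`,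
`λ⁴ = -1/θ` on the windows `[0, (k+1)t/ι]` and the time-weighted rows on the cells `[jt/ι, (j+1)t/ι]`.

Proof (glue): horizon `t < T' ≤ T` (`exists_horizon_of_packing_lt`), smooth rows on `[0, T')`
(`isSmoothSpaceTimeOn_logProfileRows`), `C¹` bounds and moduli (`exists_bounds_moduli_of_isSmoothSpaceTimeOn`);
the `4i` events of grid size `i` (type `q % 4`, index `q / 4`) are LITERALLY the K-stub events of the
`C¹`-normalised tests `Λ⁻¹ • row`, `(2Λ)⁻¹ • ((s' - r) • row)` (admissibility lemmas below, adapted from the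
landed `…TestAdmissibility`) with `δ = 1/(i+1)²`; `ℓ_N → 0` gives the side conditions; the engine
`exists_goodEvents_of_import` gives `ι`, `G'`; on `G' N` the raw defect bounds follow by linearity
(`momDefect_const_smul`, `enDefect_const_mul`), the modulus is moved from `∂ₜ` within `[0, T')` to `[0, T)`
(`timeDerivWithin_Ico_eq_of_le`). No definitions, no named facts. Reference: H.-T. Yau, LMP 22 (1991) §2.
-/

noncomputable section

namespace Summit.AtomisticToContinuum.HydrodynamicLimit.Theorems.NearConstantShortTimeHL

open scoped BigOperators ENNReal Topology
open MeasureTheory Set Filter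
open Literature.MathematicalPhysics.KineticTheory Literature.Analysis.FluidPDE Literature.Analysis.FunctionSpaces

/-! ### Admissible tests (adapted from `…RelayRaceLocalityNearConstantShortTimeHLTestAdmissibility`) -/

/-- Scaling a norm bound: `0 ≤ a`, `‖v‖ ≤ b`, `a b ≤ c` give `‖a • v‖ ≤ c` (used with `a = Λ⁻¹` and with a
time weight `a = s' - r ∈ [0, 1]`). [folklore] -/
theorem xx_norm_smul_le {F' : Type*} [NormedAddCommGroup F'] [NormedSpace ℝ F'] {a b c : ℝ} (ha : 0 ≤ a)
    {v : F'} (hv : ‖v‖ ≤ b) (hab : a * b ≤ c) : ‖a • v‖ ≤ c := by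
  rw [norm_smul, Real.norm_eq_abs, abs_of_nonneg ha]
  exact (mul_le_mul_of_nonneg_left hv ha).trans hab

/-- **Admissibility of the `C¹`-normalised row** `Λ⁻¹ • f` on a window `[s, s'] ⊆ [0, T')` under `Λ`-bounds of
`f, ∂ₜ f, ∂ᵢ f` (adapted from the landed `rowTest_admissible`). [folklore] -/
theorem xx_rowTest_admissible {F' : Type*} [NormedAddCommGroup F'] [NormedSpace ℝ F'] {T' s s' : ℝ}
    {f : ℝ → T3 → F'} (hf : Torus.IsSmoothSpaceTimeOn (Set.Ico 0 T') f) (hs : 0 ≤ s) (hss' : s < s')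
    (hs' : s' < T') {Λ : ℝ} (hΛ : 0 < Λ) (hB : ∀ r ∈ Set.Icc s s', ∀ x, ‖f r x‖ ≤ Λ ∧
      ‖Torus.timeDerivWithin (Set.Ico 0 T') f r x‖ ≤ Λ ∧ ∀ i, ‖Torus.partialDeriv i (f r) x‖ ≤ Λ) :
    Torus.IsSmoothSpaceTimeOn (Set.Icc s s') (fun r y => Λ⁻¹ • f r y) ∧ ∀ r ∈ Set.Icc s s', ∀ x,
      ‖(fun r y => Λ⁻¹ • f r y) r x‖ ≤ 1 ∧
      ‖Torus.timeDerivWithin (Set.Icc s s') (fun r y => Λ⁻¹ • f r y) r x‖ ≤ 1 ∧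
      ∀ i, ‖Torus.partialDeriv i ((fun r y => Λ⁻¹ • f r y) r) x‖ ≤ 1 := by
  have hsub : Set.Icc s s' ⊆ Set.Ico 0 T' := fun τ hτ => ⟨hs.trans hτ.1, hτ.2.trans_lt hs'⟩
  have hn1 : ∀ {v : F'}, ‖v‖ ≤ Λ → ‖Λ⁻¹ • v‖ ≤ 1 := fun hv =>
    xx_norm_smul_le (inv_nonneg.2 hΛ.le) hv (inv_mul_cancel₀ hΛ.ne').le
  refine ⟨(hf.mono hsub).const_smul Λ⁻¹, fun r hr x => ⟨hn1 (hB r hr x).1, ?_, fun i => ?_⟩⟩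
  · rw [we_timeDerivWithin_const_smul, timeDerivWithin_Icc_eq_of_isSmoothSpaceTimeOn hf hs hss' hs' hr x]
    exact hn1 (hB r hr x).2.1
  · show ‖Torus.partialDeriv i (fun y => Λ⁻¹ • f r y) x‖ ≤ 1
    rw [DenseExcursionAthermalScaling.partialDeriv_const_smul]
    exact hn1 ((hB r hr x).2.2 i)

/-- **Admissibility of the `C¹`-normalised weighted row** `(2Λ)⁻¹ • ((s' - r) • f)` on a window
`[s, s'] ⊆ [0, T')` of length `≤ 1`: product rule `∂ₜ((s' - r) • f) = (s' - r) • ∂ₜ f - f` within `[s, s']`,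
`‖·‖ ≤ 2Λ` (adapted from the landed `weightedRowTest_admissible`). [folklore] -/
theorem xx_weightedRowTest_admissible {F' : Type*} [NormedAddCommGroup F'] [NormedSpace ℝ F']
    {T' s s' : ℝ} {f : ℝ → T3 → F'} (hf : Torus.IsSmoothSpaceTimeOn (Set.Ico 0 T') f) (hs : 0 ≤ s)
    (hss' : s < s') (hs' : s' < T') (hlen : s' - s ≤ 1) {Λ : ℝ} (hΛ : 0 < Λ)
    (hB : ∀ r ∈ Set.Icc s s', ∀ x, ‖f r x‖ ≤ Λ ∧ ‖Torus.timeDerivWithin (Set.Ico 0 T') f r x‖ ≤ Λ ∧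
      ∀ i, ‖Torus.partialDeriv i (f r) x‖ ≤ Λ) :
    Torus.IsSmoothSpaceTimeOn (Set.Icc s s') (fun r y => (2 * Λ)⁻¹ • ((s' - r) • f r y)) ∧
      ∀ r ∈ Set.Icc s s', ∀ x, ‖(fun r y => (2 * Λ)⁻¹ • ((s' - r) • f r y)) r x‖ ≤ 1 ∧
        ‖Torus.timeDerivWithin (Set.Icc s s') (fun r y => (2 * Λ)⁻¹ • ((s' - r) • f r y)) r x‖ ≤ 1 ∧
        ∀ i, ‖Torus.partialDeriv i ((fun r y => (2 * Λ)⁻¹ • ((s' - r) • f r y)) r) x‖ ≤ 1 := by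
  have hsub : Set.Icc s s' ⊆ Set.Ico 0 T' := fun τ hτ => ⟨hs.trans hτ.1, hτ.2.trans_lt hs'⟩
  have h2Λ : 0 < 2 * Λ := by positivity
  -- the affine weight `(r, y) ↦ s' - r` is jointly smooth (its lift is `p ↦ s' - p.1`)
  have hwt : Torus.IsSmoothSpaceTimeOn (Set.Icc s s') (fun (r : ℝ) (_ : T3) => s' - r) :=
    Torus.isSmoothSpaceTimeOn_of_contDiff
      (show ContDiff ℝ ((⊤ : ℕ∞) : WithTop ℕ∞) (fun p : ℝ × EuclideanSpace ℝ (Fin 3) => s' - p.1) from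
        contDiff_const.sub contDiff_fst) _
  refine ⟨(hwt.smul (hf.mono hsub)).const_smul (2 * Λ)⁻¹, fun r hr x => ?_⟩
  have hw0 : 0 ≤ s' - r := sub_nonneg.2 hr.2
  have hw1 : s' - r ≤ 1 := by linarith [hr.1]
  have hN2 : ∀ {v : F'}, ‖v‖ ≤ 2 * Λ → ‖(2 * Λ)⁻¹ • v‖ ≤ 1 := fun hv =>
    xx_norm_smul_le (inv_nonneg.2 h2Λ.le) hv (inv_mul_cancel₀ h2Λ.ne').le
  have hW : ∀ {v : F'}, ‖v‖ ≤ Λ → ‖(s' - r) • v‖ ≤ Λ := fun hv =>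
    xx_norm_smul_le hw0 hv (mul_le_of_le_one_left hΛ.le hw1)
  obtain ⟨hf0, hft, hfx⟩ := hB r hr x
  refine ⟨hN2 ((hW hf0).trans (by linarith)), ?_, fun i => ?_⟩
  · -- product rule for the slice `τ ↦ (s' - τ) • f τ x` on the set of unique differentiability `[s, s']`
    have hd : Torus.timeDerivWithin (Set.Icc s s') (fun r y => (s' - r) • f r y) r x =
        (s' - r) • Torus.timeDerivWithin (Set.Ico 0 T') f r x + (-1 : ℝ) • f r x :=
      (((hasDerivWithinAt_id (x := r) (s := Set.Icc s s')).const_sub s').smul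
        ((hf.hasDerivWithinAt_slice (hsub hr) x).mono hsub)).derivWithin (uniqueDiffOn_Icc hss' r hr)
    rw [we_timeDerivWithin_const_smul (Set.Icc s s') (2 * Λ)⁻¹ (fun r y => (s' - r) • f r y) r x, hd,
      neg_one_smul]
    refine hN2 ((norm_add_le _ _).trans ?_)
    rw [norm_neg]
    linarith [hW hft]
  · show ‖Torus.partialDeriv i (fun y => (2 * Λ)⁻¹ • ((s' - r) • f r y)) x‖ ≤ 1
    rw [DenseExcursionAthermalScaling.partialDeriv_const_smul,
      DenseExcursionAthermalScaling.partialDeriv_const_smul (s' - r) (f r)]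
    exact hN2 ((hW (hfx i)).trans (by linarith))

/-- For scalar tests the `C¹` size bounds in norm are the ones in absolute value. [folklore] -/
theorem xx_abs_of_norm {S : Set ℝ} {φ : ℝ → T3 → ℝ}
    (h : ∀ r ∈ S, ∀ x, ‖φ r x‖ ≤ 1 ∧ ‖Torus.timeDerivWithin S φ r x‖ ≤ 1 ∧
      ∀ i, ‖Torus.partialDeriv i (φ r) x‖ ≤ 1) :
    ∀ r ∈ S, ∀ x, |φ r x| ≤ 1 ∧ |Torus.timeDerivWithin S φ r x| ≤ 1 ∧
      ∀ i, |Torus.partialDeriv i (φ r) x| ≤ 1 := fun r hr x =>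
  ⟨(Real.norm_eq_abs _).symm.trans_le (h r hr x).1, (Real.norm_eq_abs _).symm.trans_le (h r hr x).2.1,
    fun i => (Real.norm_eq_abs _).symm.trans_le ((h r hr x).2.2 i)⟩

/-! ### From the normalised defects to the raw ones; grid arithmetic -/

/-- **Momentum defect: normalised to raw.** If the windowed momentum defect of `c⁻¹ • g` is `≤ δ` in absolute
value (`0 < c`), the one of `g` is `≤ c δ` (`momDefect_const_smul`). [folklore] -/
theorem xx_mom_of_normalised {σ ε : ℝ} {m : ℕ} (Φ : HardSphereFlow (Torus.geometry (Fin 3)) ε m)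
    (z : Config m (Fin 3) T3) (ℓ : ℝ) {s τ : ℝ} (hτ : 0 < τ) {g : ℝ → T3 → V3} {c δ : ℝ} (hc : 0 < c)
    (hsm : Torus.IsSmoothSpaceTimeOn (Set.Icc s (s + τ)) (fun r y => c⁻¹ • g r y))
    (hb : |momDefect σ Φ z ℓ s τ (fun r y => c⁻¹ • g r y)| ≤ δ) : |momDefect σ Φ z ℓ s τ g| ≤ c * δ := by
  have h : momDefect σ Φ z ℓ s τ g = c * momDefect σ Φ z ℓ s τ (fun r y => c⁻¹ • g r y) := by
    convert momDefect_const_smul (σ := σ) Φ z ℓ hτ hsm c using 2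
    funext r y
    simp only [smul_smul, mul_inv_cancel₀ hc.ne', one_smul]
  rw [h, abs_mul, abs_of_pos hc]
  exact mul_le_mul_of_nonneg_left hb hc.le

/-- **Energy defect: normalised to raw.** If the windowed energy defect of `c⁻¹ g` is `≤ δ` in absolute value
(`0 < c`), the one of `g` is `≤ c δ` (`enDefect_const_mul`). [folklore] -/
theorem xx_en_of_normalised {σ ε : ℝ} {m : ℕ} (Φ : HardSphereFlow (Torus.geometry (Fin 3)) ε m)
    (z : Config m (Fin 3) T3) (ℓ : ℝ) {s τ : ℝ} (hτ : 0 < τ) {g : ℝ → T3 → ℝ} {c δ : ℝ} (hc : 0 < c)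
    (hsm : Torus.IsSmoothSpaceTimeOn (Set.Icc s (s + τ)) (fun r y => c⁻¹ • g r y))
    (hb : |enDefect σ Φ z ℓ s τ (fun r y => c⁻¹ • g r y)| ≤ δ) : |enDefect σ Φ z ℓ s τ g| ≤ c * δ := by
  have h : enDefect σ Φ z ℓ s τ g = c * enDefect σ Φ z ℓ s τ (fun r y => c⁻¹ • g r y) := by
    convert enDefect_const_mul (σ := σ) Φ z ℓ hτ hsm c using 2
    funext r y
    simp only [smul_eq_mul, mul_inv_cancel_left₀ hc.ne']
  rw [h, abs_mul, abs_of_pos hc]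
  exact mul_le_mul_of_nonneg_left hb hc.le

/-- The final shape of the defect bounds: `Λ ((i+1)⁻¹)² ≤ 2Λ/(i+1)²` and `2Λ ((i+1)⁻¹)² = 2Λ/(i+1)²`. [folklore] -/
theorem xx_bound {Λ : ℝ} (hΛ : 0 < Λ) (i : ℕ) :
    Λ * (((i : ℝ) + 1)⁻¹ ^ 2) ≤ 2 * Λ / ((i : ℝ) + 1) ^ 2 ∧
      2 * Λ * (((i : ℝ) + 1)⁻¹ ^ 2) = 2 * Λ / ((i : ℝ) + 1) ^ 2 := by
  rw [inv_pow, ← div_eq_mul_inv, ← div_eq_mul_inv]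
  exact ⟨div_le_div_of_nonneg_right (by linarith) (by positivity), rfl⟩

/-- Window arithmetic: for `j < i`, `0 < t < 1`, `t < T'`, the window `[0, 0 + (j+1) t/i]` has positive length,
ends before `T'` and `1`, and lies in `[0, t]`. [folklore] -/
theorem xx_window {t T' : ℝ} (ht0 : 0 < t) (ht1 : t < 1) (htT' : t < T') {i j : ℕ} (hji : j < i) :
    0 < ((j : ℝ) + 1) * (t / i) ∧ (0 : ℝ) < 0 + ((j : ℝ) + 1) * (t / i) ∧
      0 + ((j : ℝ) + 1) * (t / i) < T' ∧ 0 + ((j : ℝ) + 1) * (t / i) ≤ 1 ∧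
      Set.Icc (0 : ℝ) (0 + ((j : ℝ) + 1) * (t / i)) ⊆ Set.Icc 0 t := by
  have hi : (0 : ℝ) < i := Nat.cast_pos.2 (lt_of_le_of_lt (Nat.zero_le j) hji)
  have hji' : (j : ℝ) + 1 ≤ i := by exact_mod_cast Nat.succ_le_of_lt hji
  have hpos : 0 < ((j : ℝ) + 1) * (t / i) := mul_pos (by positivity) (div_pos ht0 hi)
  have hle : ((j : ℝ) + 1) * (t / i) ≤ t :=
    (mul_le_mul_of_nonneg_right hji' (div_pos ht0 hi).le).trans_eq (mul_div_cancel₀ t hi.ne')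
  rw [zero_add]
  exact ⟨hpos, hpos, hle.trans_lt htT', hle.trans ht1.le, Set.Icc_subset_Icc_right hle⟩

/-- Cell arithmetic: for `j < i`, `0 < t < 1`, `t < T'`, the cell `[j t/i, j t/i + t/i]` starts at a nonnegative
time, has positive length `≤ 1`, ends before `T'` and `1`, and lies in `[0, t]`. [folklore] -/
theorem xx_cell {t T' : ℝ} (ht0 : 0 < t) (ht1 : t < 1) (htT' : t < T') {i j : ℕ} (hji : j < i) :
    0 ≤ (j : ℝ) * (t / i) ∧ 0 < t / i ∧ (j : ℝ) * (t / i) < (j : ℝ) * (t / i) + t / i ∧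
      (j : ℝ) * (t / i) + t / i < T' ∧ (j : ℝ) * (t / i) + t / i - (j : ℝ) * (t / i) ≤ 1 ∧
      (j : ℝ) * (t / i) + t / i ≤ 1 ∧ Set.Icc ((j : ℝ) * (t / i)) ((j : ℝ) * (t / i) + t / i) ⊆ Set.Icc 0 t := by
  have hi : (0 : ℝ) < i := Nat.cast_pos.2 (lt_of_le_of_lt (Nat.zero_le j) hji)
  have h1i : (1 : ℝ) ≤ i := by exact_mod_cast Nat.succ_le_of_lt (lt_of_le_of_lt (Nat.zero_le j) hji)
  have hτ : 0 < t / i := div_pos ht0 hi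
  have hs : 0 ≤ (j : ℝ) * (t / i) := mul_nonneg (Nat.cast_nonneg j) hτ.le
  have hle : (j : ℝ) * (t / i) + t / i ≤ t := by
    have hji' : (j : ℝ) + 1 ≤ i := by exact_mod_cast Nat.succ_le_of_lt hji
    have h' := mul_le_mul_of_nonneg_right hji' hτ.le
    rw [add_mul, one_mul, mul_div_cancel₀ t hi.ne'] at h'
    exact h'
  refine ⟨hs, hτ, lt_add_of_pos_right _ hτ, hle.trans_lt htT', ?_, hle.trans ht1.le, Set.Icc_subset_Icc hs hle⟩
  rw [add_sub_cancel_left]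
  exact (div_le_self ht0.le h1i).trans ht1.le

/-! ### The stub -/

/-- **Registered stub `good_event_package` (level 1a of the Grönwall assembly).** The good events of Yau's
method, eventually in `N`: a `C¹` constant `Λ` of the log-profile rows, a diagonal grid index `ι(N) → ∞`,
measurable good events `G' N` with `P N (G' N)ᶜ → 0`, and eventually `0 < ι N`, `0 < ℓ_N < 1/2`, the modulus
`1/(ι N + 1)` of `∂ₜλ⁰, ∂ₜλ, ∂ₜλ⁴, ∇λ⁰` at scale `ℓ_N` on `[0, t]`, and on `G' N` the speed and packing caps on
`[0, t]` together with the closure-defect bounds `2Λ/(ι N + 1)²` for the plain rows on the windows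
`[0, (k+1)t/ι]` and the time-weighted rows on the cells `[jt/ι, (j+1)t/ι]` (event import + closure K-stubs +
cap failures, through `exists_goodEvents_of_import`). [cite: Yau1991, §2] -/
theorem good_event_package : ∀ {η₀ : ℝ} {F : ℝ → ℝ}, 0 < η₀ → AnalyticOnNhd ℝ F (Set.Ioo (-η₀) η₀) → Set.EqOn hsExcessFreeEnergy F (Set.Ico 0 η₀) → ∀ {σ T : ℝ}, 0 < σ → ∀ {ρ θ : ℝ → T3 → ℝ} {u : ℝ → T3 → V3}, IsHardSphereEulerSolution σ T ρ u θ → ∀ {t : ℝ}, t ∈ Set.Ico 0 T → 0 < t → t < 1 → (∀ s ∈ Set.Icc 0 t, ∀ x, ρ s x * σ ^ 3 < η₀) → ∀ {ηP : ℝ} {ε : ℕ → ℝ} {n : ℕ → ℕ}, Tendsto n atTop atTop → ∀ (Φ : (N : ℕ) → HardSphereFlow (Torus.geometry (Fin 3)) (ε N) (n N)) (P G : (N : ℕ) → Measure (Config (n N) (Fin 3) T3)) {aI c₀ : ℝ}, aI < c₀ → (∀ N (S : Set (Config (n N) (Fin 3) T3)), P N S ≤ ENNReal.ofReal (Real.exp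 (aI * n N)) * G N S) → ∀ {η₂ η₃ : ℝ}, ηP ≤ η₂ → ηP ≤ η₃ → (∀ (s τ : ℝ), 0 ≤ s → 0 < τ → s + τ ≤ 1 → ∀ ψ : ℝ → T3 → V3, Torus.IsSmoothSpaceTimeOn (Set.Icc s (s + τ)) ψ → (∀ r ∈ Set.Icc s (s + τ), ∀ x, ‖ψ r x‖ ≤ 1 ∧ ‖Torus.timeDerivWithin (Set.Icc s (s + τ)) ψ r x‖ ≤ 1 ∧ ∀ i, ‖Torus.partialDeriv i (ψ r) x‖ ≤ 1) → ∀ δ : ℝ, 0 < δ → ∀ᶠ N : ℕ in atTop, G N {z | speedCapOn (Φ N) z (Set.Icc s (s + τ)) ((n N : ℝ) ^ (1 / 24 : ℝ)) ∧ packCapOn (Φ N) z (Set.Icc s (s + τ)) (mesoRadius (n N)) σ η₂ ∧ δ < |momDefect σ (Φ N) z (mesoRadius (n N)) s τ ψ|} ≤ ENNReal.ofReal (Real.exp (-(c₀ * n N)))) → (∀ (s τ : ℝ), 0 ≤ s → 0 < τ → s + τ ≤ 1 → ∀ φ : ℝ → T3 → ℝ, Torus.IsSmoothSpaceTimeOn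 (Set.Icc s (s + τ)) φ → (∀ r ∈ Set.Icc s (s + τ), ∀ x, |φ r x| ≤ 1 ∧ |Torus.timeDerivWithin (Set.Icc s (s + τ)) φ r x| ≤ 1 ∧ ∀ i, |Torus.partialDeriv i (φ r) x| ≤ 1) → ∀ δ : ℝ, 0 < δ → ∀ᶠ N : ℕ in atTop, G N {z | speedCapOn (Φ N) z (Set.Icc s (s + τ)) ((n N : ℝ) ^ (1 / 24 : ℝ)) ∧ packCapOn (Φ N) z (Set.Icc s (s + τ)) (mesoRadius (n N)) σ η₃ ∧ δ < |enDefect σ (Φ N) z (mesoRadius (n N)) s τ φ|} ≤ ENNReal.ofReal (Real.exp (-(c₀ * n N)))) → Tendsto (fun N => P N {z | ∃ r ∈ Set.Icc 0 t, ∃ i, (n N : ℝ) ^ (1 / 24 : ℝ) < ‖((Φ N).flow r z i).2‖}) atTop (nhds 0) → Tendsto (fun N => P N {z | ∃ r ∈ Set.Icc 0 t, ∃ x : T3, ηP < empiricalDensityField ((Φ N).flow r z) (ballKernel (mesoRadius (n N)) x) * σ ^ 3}) atTop (nhds 0) → ∃ Λ : ℝ, 0 < Λ ∧ ∃ ι :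 ℕ → ℕ, Tendsto ι atTop atTop ∧ ∃ G' : (N : ℕ) → Set (Config (n N) (Fin 3) T3), (∀ N, MeasurableSet (G' N)) ∧ Tendsto (fun N => P N (G' N)ᶜ) atTop (nhds 0) ∧ ∀ᶠ N in atTop, 0 < ι N ∧ 0 < mesoRadius (n N) ∧ mesoRadius (n N) < 1 / 2 ∧ (∀ r ∈ Set.Icc 0 t, ∀ x y : T3, Torus.euclidDist x y < mesoRadius (n N) → |Torus.timeDerivWithin (Set.Ico 0 T) (lam0Row σ ρ θ u) r x - Torus.timeDerivWithin (Set.Ico 0 T) (lam0Row σ ρ θ u) r y| ≤ ((ι N : ℝ) + 1)⁻¹ ∧ ‖Torus.timeDerivWithin (Set.Ico 0 T) (lamRow θ u) r x - Torus.timeDerivWithin (Set.Ico 0 T) (lamRow θ u) r y‖ ≤ ((ι N : ℝ) + 1)⁻¹ ∧ |Torus.timeDerivWithin (Set.Ico 0 T) (lam4Row θ) r x - Torus.timeDerivWithin (Set.Ico 0 T) (lam4Row θ) r y| ≤ ((ι N : ℝ) + 1)⁻¹ ∧ ∀ k, |Torus.partialDeriv k (lam0Row σ ρ θ u r) x - Torus.partialDeriv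 k (lam0Row σ ρ θ u r) y| ≤ ((ι N : ℝ) + 1)⁻¹) ∧ ∀ z ∈ G' N, z ∈ (Φ N).good → speedCapOn (Φ N) z (Set.Icc 0 t) ((n N : ℝ) ^ (1 / 24 : ℝ)) ∧ packCapOn (Φ N) z (Set.Icc 0 t) (mesoRadius (n N)) σ ηP ∧ (∀ k : ℕ, k < ι N → |momDefect σ (Φ N) z (mesoRadius (n N)) 0 ((k + 1) * (t / ι N)) (lamRow θ u)| ≤ 2 * Λ / ((ι N : ℝ) + 1) ^ 2 ∧ |enDefect σ (Φ N) z (mesoRadius (n N)) 0 ((k + 1) * (t / ι N)) (lam4Row θ)| ≤ 2 * Λ / ((ι N : ℝ) + 1) ^ 2) ∧ (∀ j : ℕ, j < ι N → |momDefect σ (Φ N) z (mesoRadius (n N)) (j * (t / ι N)) (t / ι N) (fun r y => (j * (t / ι N) + t / ι N - r) • lamRow θ u r y)| ≤ 2 * Λ / ((ι N : ℝ) + 1) ^ 2 ∧ |enDefect σ (Φ N) z (mesoRadius (n N)) (j * (t / ι N)) (t / ι N) (fun r y => (j * (t / ι N) + t / ι N - r) * lam4Row θ r y)| ≤ 2 *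 Λ / ((ι N : ℝ) + 1) ^ 2) := by
  intro η₀ F hη₀ hFa hEqF σ T hσ ρ θ u hE t ht ht0 ht1 hband ηP ε n hn Φ P G aI c₀ hac hImp η₂ η₃ hη₂ hη₃
    hKmom hKen hV hW
  -- (0) horizon `T'`, smooth rows on `[0, T')`, `C¹` bounds `Λ` and moduli radii on `[0, t]`
  obtain ⟨T', htT', hT'T, hband'⟩ := exists_horizon_of_packing_lt hE hσ ht hband
  obtain ⟨hlam0, hlam, hlam4⟩ : Torus.IsSmoothSpaceTimeOn (Set.Ico 0 T') (lam0Row σ ρ θ u) ∧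
      Torus.IsSmoothSpaceTimeOn (Set.Ico 0 T') (lamRow θ u) ∧
      Torus.IsSmoothSpaceTimeOn (Set.Ico 0 T') (lam4Row θ) :=
    isSmoothSpaceTimeOn_logProfileRows hη₀ hFa hEqF hσ hE hT'T hband'
  obtain ⟨-, hm0⟩ := exists_bounds_moduli_of_isSmoothSpaceTimeOn hlam0 ht.1 htT'
  obtain ⟨⟨Λ₁, hΛ₁, hb1, -⟩, hm1⟩ := exists_bounds_moduli_of_isSmoothSpaceTimeOn hlam ht.1 htT'
  obtain ⟨⟨Λ₄, -, hb4, -⟩, hm4⟩ := exists_bounds_moduli_of_isSmoothSpaceTimeOn hlam4 ht.1 htT'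
  obtain ⟨Λ, hΛ1, hΛ4, hΛpos⟩ : ∃ Λ : ℝ, Λ₁ ≤ Λ ∧ Λ₄ ≤ Λ ∧ 0 < Λ :=
    ⟨max Λ₁ Λ₄, le_max_left _ _, le_max_right _ _, lt_max_of_lt_left hΛ₁⟩
  have h2Λ : 0 < 2 * Λ := by positivity
  have hBΛ1 : ∀ r ∈ Set.Icc 0 t, ∀ x, ‖lamRow θ u r x‖ ≤ Λ ∧
      ‖Torus.timeDerivWithin (Set.Ico 0 T') (lamRow θ u) r x‖ ≤ Λ ∧
      ∀ i, ‖Torus.partialDeriv i (lamRow θ u r) x‖ ≤ Λ := fun r hr x =>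
    ⟨(hb1 r hr x).1.trans hΛ1, (hb1 r hr x).2.1.trans hΛ1, fun i => ((hb1 r hr x).2.2 i).trans hΛ1⟩
  have hBΛ4 : ∀ r ∈ Set.Icc 0 t, ∀ x, ‖lam4Row θ r x‖ ≤ Λ ∧
      ‖Torus.timeDerivWithin (Set.Ico 0 T') (lam4Row θ) r x‖ ≤ Λ ∧
      ∀ i, ‖Torus.partialDeriv i (lam4Row θ r) x‖ ≤ Λ := fun r hr x =>
    ⟨(hb4 r hr x).1.trans hΛ4, (hb4 r hr x).2.1.trans hΛ4, fun i => ((hb4 r hr x).2.2 i).trans hΛ4⟩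
  have he : ∀ i : ℕ, (0 : ℝ) < ((i : ℝ) + 1)⁻¹ := fun i => by positivity
  have hδ : ∀ i : ℕ, (0 : ℝ) < ((i : ℝ) + 1)⁻¹ ^ 2 := fun i => by positivity
  choose d0 hd0 hmod0 using hm0
  choose d1 hd1 hmod1 using hm1
  choose d4 hd4 hmod4 using hm4
  obtain ⟨dd, hdd⟩ : ∃ dd : ℕ → ℝ, ∀ i, dd i = min (d0 _ (he i)) (min (d1 _ (he i)) (d4 _ (he i))) :=
    ⟨_, fun _ => rfl⟩
  have hddpos : ∀ i, 0 < dd i := fun i => by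
    rw [hdd]
    exact lt_min (hd0 _ _) (lt_min (hd1 _ _) (hd4 _ _))
  -- the admissible normalised tests on the windows `[0, (j+1)t/i]` and the cells `[jt/i, (j+1)t/i]`, `j < i`
  have hw := fun (i j : ℕ) (hij : j < i) => xx_window ht0 ht1 htT' hij
  have hcl := fun (i j : ℕ) (hij : j < i) => xx_cell ht0 ht1 htT' hij
  have adm0 := fun (i j : ℕ) (hij : j < i) => xx_rowTest_admissible hlam le_rfl (hw i j hij).2.1
    (hw i j hij).2.2.1 hΛpos fun r hr x => hBΛ1 r ((hw i j hij).2.2.2.2 hr) x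
  have adm1 := fun (i j : ℕ) (hij : j < i) => xx_rowTest_admissible hlam4 le_rfl (hw i j hij).2.1
    (hw i j hij).2.2.1 hΛpos fun r hr x => hBΛ4 r ((hw i j hij).2.2.2.2 hr) x
  have adm2 := fun (i j : ℕ) (hij : j < i) => xx_weightedRowTest_admissible hlam (hcl i j hij).1
    (hcl i j hij).2.2.1 (hcl i j hij).2.2.2.1 (hcl i j hij).2.2.2.2.1 hΛpos
    fun r hr x => hBΛ1 r ((hcl i j hij).2.2.2.2.2.2 hr) x
  have adm3 := fun (i j : ℕ) (hij : j < i) => xx_weightedRowTest_admissible hlam4 (hcl i j hij).1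
    (hcl i j hij).2.2.1 (hcl i j hij).2.2.2.1 (hcl i j hij).2.2.2.2.1 hΛpos
    fun r hr x => hBΛ4 r ((hcl i j hij).2.2.2.2.2.2 hr) x
  -- (1) the closure-defect events of grid size `i`: type `q % 4`, window/cell index `q / 4`
  obtain ⟨E, hE⟩ : ∃ E : ℕ → ℕ → (N : ℕ) → Set (Config (n N) (Fin 3) T3), ∀ i q N, E i q N =
      if q % 4 = 0 then
        {z | speedCapOn (Φ N) z (Set.Icc 0 (0 + (((q / 4 : ℕ) : ℝ) + 1) * (t / i))) ((n N : ℝ) ^ (1 / 24 : ℝ)) ∧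
          packCapOn (Φ N) z (Set.Icc 0 (0 + (((q / 4 : ℕ) : ℝ) + 1) * (t / i))) (mesoRadius (n N)) σ η₂ ∧
          ((i : ℝ) + 1)⁻¹ ^ 2 < |momDefect σ (Φ N) z (mesoRadius (n N)) 0 ((((q / 4 : ℕ) : ℝ) + 1) * (t / i))
            (fun r y => Λ⁻¹ • lamRow θ u r y)|}
      else if q % 4 = 1 then
        {z | speedCapOn (Φ N) z (Set.Icc 0 (0 + (((q / 4 : ℕ) : ℝ) + 1) * (t / i))) ((n N : ℝ) ^ (1 / 24 : ℝ)) ∧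
          packCapOn (Φ N) z (Set.Icc 0 (0 + (((q / 4 : ℕ) : ℝ) + 1) * (t / i))) (mesoRadius (n N)) σ η₃ ∧
          ((i : ℝ) + 1)⁻¹ ^ 2 < |enDefect σ (Φ N) z (mesoRadius (n N)) 0 ((((q / 4 : ℕ) : ℝ) + 1) * (t / i))
            (fun r y => Λ⁻¹ • lam4Row θ r y)|}
      else if q % 4 = 2 then
        {z | speedCapOn (Φ N) z (Set.Icc (((q / 4 : ℕ) : ℝ) * (t / i)) (((q / 4 : ℕ) : ℝ) * (t / i) + t / i))
            ((n N : ℝ) ^ (1 / 24 : ℝ)) ∧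
          packCapOn (Φ N) z (Set.Icc (((q / 4 : ℕ) : ℝ) * (t / i)) (((q / 4 : ℕ) : ℝ) * (t / i) + t / i))
            (mesoRadius (n N)) σ η₂ ∧
          ((i : ℝ) + 1)⁻¹ ^ 2 < |momDefect σ (Φ N) z (mesoRadius (n N)) (((q / 4 : ℕ) : ℝ) * (t / i)) (t / i)
            (fun r y => (2 * Λ)⁻¹ • ((((q / 4 : ℕ) : ℝ) * (t / i) + t / i - r) • lamRow θ u r y))|}
      else
        {z | speedCapOn (Φ N) z (Set.Icc (((q / 4 : ℕ) : ℝ) * (t / i)) (((q / 4 : ℕ) : ℝ) * (t / i) + t / i))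
            ((n N : ℝ) ^ (1 / 24 : ℝ)) ∧
          packCapOn (Φ N) z (Set.Icc (((q / 4 : ℕ) : ℝ) * (t / i)) (((q / 4 : ℕ) : ℝ) * (t / i) + t / i))
            (mesoRadius (n N)) σ η₃ ∧
          ((i : ℝ) + 1)⁻¹ ^ 2 < |enDefect σ (Φ N) z (mesoRadius (n N)) (((q / 4 : ℕ) : ℝ) * (t / i)) (t / i)
            (fun r y => (2 * Λ)⁻¹ • ((((q / 4 : ℕ) : ℝ) * (t / i) + t / i - r) • lam4Row θ r y))|} :=
    ⟨_, fun _ _ _ => rfl⟩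
  -- `G`-exponential smallness of every event, for each fixed grid size `i` (the closure K-stubs)
  have hEsmall : ∀ i, ∀ q < 4 * i, ∀ᶠ N in atTop,
      G N (E i q N) ≤ ENNReal.ofReal (Real.exp (-(c₀ * n N))) := by
    intro i q hq
    have hj : q / 4 < i := by omega
    obtain h | h | h | h : q % 4 = 0 ∨ q % 4 = 1 ∨ q % 4 = 2 ∨ q % 4 = 3 := by omega
    · refine (hKmom 0 _ le_rfl (hw i _ hj).1 (hw i _ hj).2.2.2.1 _ (adm0 i _ hj).1 (adm0 i _ hj).2 _
        (hδ i)).mono fun N hN => ?_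
      rw [hE, if_pos h]
      exact hN
    · refine (hKen 0 _ le_rfl (hw i _ hj).1 (hw i _ hj).2.2.2.1 _ (adm1 i _ hj).1
        (xx_abs_of_norm (adm1 i _ hj).2) _ (hδ i)).mono fun N hN => ?_
      rw [hE, if_neg (show ¬q % 4 = 0 by omega), if_pos h]
      exact hN
    · refine (hKmom _ _ (hcl i _ hj).1 (hcl i _ hj).2.1 (hcl i _ hj).2.2.2.2.2.1 _ (adm2 i _ hj).1
        (adm2 i _ hj).2 _ (hδ i)).mono fun N hN => ?_
      rw [hE, if_neg (show ¬q % 4 = 0 by omega), if_neg (show ¬q % 4 = 1 by omega), if_pos h]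
      exact hN
    · refine (hKen _ _ (hcl i _ hj).1 (hcl i _ hj).2.1 (hcl i _ hj).2.2.2.2.2.1 _ (adm3 i _ hj).1
        (xx_abs_of_norm (adm3 i _ hj).2) _ (hδ i)).mono fun N hN => ?_
      rw [hE, if_neg (show ¬q % 4 = 0 by omega), if_neg (show ¬q % 4 = 1 by omega),
        if_neg (show ¬q % 4 = 2 by omega)]
      exact hN
  -- side conditions (`ℓ_N → 0`), cap failures, and (2) the engine: diagonal index and good events
  have hmeso : Tendsto (fun N => mesoRadius (n N)) atTop (nhds 0) :=
    (tendsto_rpow_neg_atTop (by norm_num : (0 : ℝ) < 1 / 4)).comp (tendsto_natCast_atTop_atTop.comp hn)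
  have hp : ∀ i, ∀ᶠ N in atTop,
      0 < mesoRadius (n N) ∧ mesoRadius (n N) < 1 / 2 ∧ mesoRadius (n N) < dd i := fun i =>
    ((hn.eventually_ge_atTop 1).mono fun N hN => show 0 < mesoRadius (n N) from
      Real.rpow_pos_of_pos (Nat.cast_pos.2 (Nat.lt_of_lt_of_le Nat.zero_lt_one hN)) _).and
      ((hmeso.eventually_lt_const (by norm_num)).and (hmeso.eventually_lt_const (hddpos i)))
  have hBlim := hV.add hW
  rw [add_zero] at hBlim
  obtain ⟨ι, hι, hιp, G', hG'm, hG'P, hG'av⟩ := exists_goodEvents_of_import P G n hn hac hImp (fun i => 4 * i)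
    E hEsmall (fun i N => 0 < mesoRadius (n N) ∧ mesoRadius (n N) < 1 / 2 ∧ mesoRadius (n N) < dd i) hp
    (fun N => {z | ∃ r ∈ Set.Icc 0 t, ∃ i, (n N : ℝ) ^ (1 / 24 : ℝ) < ‖((Φ N).flow r z i).2‖} ∪
      {z | ∃ r ∈ Set.Icc 0 t, ∃ x : T3,
        ηP < empiricalDensityField ((Φ N).flow r z) (ballKernel (mesoRadius (n N)) x) * σ ^ 3})
    (tendsto_of_tendsto_of_tendsto_of_le_of_le tendsto_const_nhds hBlim (fun N => zero_le)
      fun N => measure_union_le _ _)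
  refine ⟨Λ, hΛpos, ι, hι, G', hG'm, hG'P, ?_⟩
  -- (3) eventually in `N`: unpack
  filter_upwards [hιp, hG'av, hι.eventually_ge_atTop 1] with N hpN havN hι1
  obtain ⟨hmpos, hmhalf, hmdd⟩ := hpN
  refine ⟨Nat.lt_of_lt_of_le Nat.zero_lt_one hι1, hmpos, hmhalf, fun r hr x y hxy => ?_, fun z hz _ => ?_⟩
  · -- the modulus of the derivative fields at scale `ℓ_N < dd (ι N)`, moved from `[0, T')` to `[0, T)`
    have hrT' : r ∈ Set.Ico 0 T' := ⟨hr.1, hr.2.trans_lt htT'⟩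
    rw [hdd] at hmdd
    obtain ⟨-, h0t, h0x⟩ := hmod0 _ (he (ι N)) r hr x y (hxy.trans (hmdd.trans_le (min_le_left _ _)))
    obtain ⟨-, h1t, -⟩ := hmod1 _ (he (ι N)) r hr x y
      (hxy.trans (hmdd.trans_le ((min_le_right _ _).trans (min_le_left _ _))))
    obtain ⟨-, h4t, -⟩ := hmod4 _ (he (ι N)) r hr x y
      (hxy.trans (hmdd.trans_le ((min_le_right _ _).trans (min_le_right _ _))))
    rw [← timeDerivWithin_Ico_eq_of_le hT'T (lam0Row σ ρ θ u) hrT' x,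
      ← timeDerivWithin_Ico_eq_of_le hT'T (lam0Row σ ρ θ u) hrT' y,
      ← timeDerivWithin_Ico_eq_of_le hT'T (lamRow θ u) hrT' x,
      ← timeDerivWithin_Ico_eq_of_le hT'T (lamRow θ u) hrT' y,
      ← timeDerivWithin_Ico_eq_of_le hT'T (lam4Row θ) hrT' x,
      ← timeDerivWithin_Ico_eq_of_le hT'T (lam4Row θ) hrT' y]
    exact ⟨(Real.norm_eq_abs _).symm.trans_le h0t, h1t, (Real.norm_eq_abs _).symm.trans_le h4t,
      fun k => (Real.norm_eq_abs _).symm.trans_le (h0x k)⟩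
  · -- on the good event: caps on `[0, t]` (no cap failure); defect bounds (avoidance + linearity)
    have hzB := havN.1 hz
    simp only [Set.mem_compl_iff, Set.mem_union, Set.mem_setOf_eq, not_or, not_exists, not_and,
      not_lt] at hzB
    have hspeed : speedCapOn (Φ N) z (Set.Icc 0 t) ((n N : ℝ) ^ (1 / 24 : ℝ)) :=
      fun r hr i => hzB.1 r hr i
    have hpack : packCapOn (Φ N) z (Set.Icc 0 t) (mesoRadius (n N)) σ ηP := fun r hr x => hzB.2 r hr x
    have hav : ∀ q : ℕ, q < 4 * ι N → z ∉ E (ι N) q N := fun q hq => havN.2 q hq hz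
    refine ⟨hspeed, hpack, fun k hk => ⟨?_, ?_⟩, fun j hj => ⟨?_, ?_⟩⟩
    · -- plain momentum row on the window `[0, (k+1) t/ι]`
      have h := hav (4 * k) (by omega)
      rw [hE, if_pos (show 4 * k % 4 = 0 by omega), show 4 * k / 4 = k by omega] at h
      simp only [Set.mem_setOf_eq, not_and, not_lt] at h
      exact (xx_mom_of_normalised (Φ N) z _ (hw _ k hk).1 hΛpos (adm0 _ k hk).1
        (h (fun r hr i => hspeed r ((hw _ k hk).2.2.2.2 hr) i)
          fun r hr x => (hpack r ((hw _ k hk).2.2.2.2 hr) x).trans hη₂)).trans (xx_bound hΛpos _).1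
    · -- plain energy row on the window `[0, (k+1) t/ι]`
      have h := hav (4 * k + 1) (by omega)
      rw [hE, if_neg (show ¬(4 * k + 1) % 4 = 0 by omega), if_pos (show (4 * k + 1) % 4 = 1 by omega),
        show (4 * k + 1) / 4 = k by omega] at h
      simp only [Set.mem_setOf_eq, not_and, not_lt] at h
      exact (xx_en_of_normalised (Φ N) z _ (hw _ k hk).1 hΛpos (adm1 _ k hk).1
        (h (fun r hr i => hspeed r ((hw _ k hk).2.2.2.2 hr) i)
          fun r hr x => (hpack r ((hw _ k hk).2.2.2.2 hr) x).trans hη₃)).trans (xx_bound hΛpos _).1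
    · -- time-weighted momentum row on the cell `[j t/ι, (j+1) t/ι]`
      have h := hav (4 * j + 2) (by omega)
      rw [hE, if_neg (show ¬(4 * j + 2) % 4 = 0 by omega), if_neg (show ¬(4 * j + 2) % 4 = 1 by omega),
        if_pos (show (4 * j + 2) % 4 = 2 by omega), show (4 * j + 2) / 4 = j by omega] at h
      simp only [Set.mem_setOf_eq, not_and, not_lt] at h
      exact (xx_mom_of_normalised (Φ N) z _ (hcl _ j hj).2.1 h2Λ (adm2 _ j hj).1
        (h (fun r hr i => hspeed r ((hcl _ j hj).2.2.2.2.2.2 hr) i)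
          fun r hr x => (hpack r ((hcl _ j hj).2.2.2.2.2.2 hr) x).trans hη₂)).trans_eq (xx_bound hΛpos _).2
    · -- time-weighted energy row on the cell `[j t/ι, (j+1) t/ι]`
      have h := hav (4 * j + 3) (by omega)
      rw [hE, if_neg (show ¬(4 * j + 3) % 4 = 0 by omega), if_neg (show ¬(4 * j + 3) % 4 = 1 by omega),
        if_neg (show ¬(4 * j + 3) % 4 = 2 by omega), show (4 * j + 3) / 4 = j by omega] at h
      simp only [Set.mem_setOf_eq, not_and, not_lt] at h
      exact (xx_en_of_normalised (Φ N) z _ (hcl _ j hj).2.1 h2Λ (adm3 _ j hj).1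
        (h (fun r hr i => hspeed r ((hcl _ j hj).2.2.2.2.2.2 hr) i)
          fun r hr x => (hpack r ((hcl _ j hj).2.2.2.2.2.2 hr) x).trans hη₃)).trans_eq (xx_bound hΛpos _).2

end Summit.AtomisticToContinuum.HydrodynamicLimit.Theorems.NearConstantShortTimeHL

end
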